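/-
Copyright: b2b-lace packet (LEAN TYPING SEAT 1, gen 20; unit `b2b-lace-lean1-g20`).  N67-S3 part 1 of `LEMMAS.md` §24
(= D10H-3 of the carver's census): the x-space LICENCE of the explicit pieces `i ≤ M` of the general-cut weighted-bubble
cell `WBX(M)` — oracle level, `d`-generic, no numeral, no dimension, no named fact, nothing of the record touched.
WHAT-IF / input-certification lane: pointer language only; no dimension sentence.
-/
import Literature.Probability.FitznerVanDerHofstad2017.WeightedBubbleSkeletonF3
import Literature.Probability.FitznerVanDerHofstad2017.SawEndpointClasses
import Literature.Probability.FitznerVanDerHofstad2017.NonRepulsiveDiagramBounds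
import Literature.Probability.Percolation.NonBacktrackingPathCounting
import HarnessLib

/-!
# The explicit pieces of the weighted-bubble skeleton in x-space ([NoBLE17-I] §5.3.3, general cut `M`)

CITATION HEADER (PLACEMENT v2). This module is part of a certified REPRODUCTION of:
R. Fitzner, R. van der Hofstad, *Mean-field behavior for nearest-neighbor percolation in d > 10*,
Electron. J. Probab. 22 (2017), no. 43, 1–65 [FvdH17], and *Generalized approach to the non-backtracking
lace expansion*, Probab. Theory Related Fields 169 (2017), 1041–1119 [NoBLE17-I] (arXiv:1506.07977, 1506.07969).
Reproduces: the evaluation of the EXPLICIT TERMS `μ̄_p^i Σ_x (a_i ⊗ ℋ_p)(x)`, `i ≤ M`, of the weighted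
repulsive bubble [NoBLE17-I] §5.3.1 (5.38) / §5.3.3 ("we extract five explicit steps … and bound the remaining
terms using `ℋ_z(x) = ‖x‖₂² G_z(x)`"; the accompanying notebook `Percolation.nb`, cell 15,
`Bound[WeightedBubble,k,s]`), in which every explicit term is a FINITE sum over the end-point classes of the
`i`-step self-avoiding walks of `|class| · c_i(class) · ‖class‖₂² · Ḡ(class)` with `Ḡ ≥ τ_p` the a-priori
two-point majorant of [FvdH17] §4.2 (4.18) + [NoBLE17-I] §5.3.2 (explicit self-avoiding-walk counts up to a cut
`L`, then the simple-random-walk tail `(2dp)^L Γ̄₂ K_{1,L}(x)`), for an ARBITRARY number `M` of explicit steps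
(print: `M = 5`).  Origin: build `lace`, node N67-S3 of `LEMMAS.md` §24 (spec `HOME/carver/g18/N67-S-SPEC.md`;
programme note `HOME/b2b-lace-enum1/g4/WBX.md` (E1)–(E2)); census row D10H-3.

## What is here (all `d`-generic; no numerals)

§1 **(E2) the pointwise two-point majorant for every cut `L`** — `tau_le_sawCounts_add_srwK`: for `d ≥ 3`,
   `p < p_c`, `f₂(p) ≤ Γ₂` and every `L : ℕ`, `x ∈ ℤ^d`,
   `τ_p(x) ≤ Σ_{r<L} p^r c_r(x) + (2dp)^L · ((2d−2)/(2d−1) Γ₂) · K_{1,L}(x)`,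
   `c_r(x) = #sawWordsTo d r x` ([FvdH17] (4.18) in the sharper self-avoiding form `tauGe_le_sawExtraction` at
   `n = 0`; `SAW ⊆ trails`; the tail in SRW form `pow_mul_sum_trailWords_tau_le`; [NoBLE17-I] §5.3.2 first display
   `srwConvTau_le_of_nobleF2_le` with one two-point line) — the `d`-generic, every-`L` form of the tree's
   `NobleWeightedDiagramBoundSmallX.tau_le_of_sum_abs_eq_two` (`‖x‖₁ = 2`, `L = 4`); with the count-majorant form
   `tau_le_counts_add_srwK` (`c_r(x) ≤ b_r`, e.g. exact tables up to the enumerated order and non-backtracking counts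
   beyond, `card_sawWordsTo_le_card_nbwWordsTo`) and the `p ≤ z` monotone form `tau_le_counts_add_srwK_of_le`
   (the cell is evaluated at an upper bound `z` for `p`).
§2 **(E1)+(E2) per explicit piece** — `sum_sawWords_sqNorm_tau_le_ofReal_classSum`: for every `i`, any class
   representatives `x_N` and reals `G_N ≥ τ_p(x_N)`,
   `Σ_{u ∈ SAW_i} ofReal ‖u(i)‖₂² · ofReal τ_p(u(i)) ≤ ofReal ( Σ_N #class_i(N) · c_i(x_N) · ‖x_N‖₂² · G_N )`
   (the landed regrouping `sum_sawWords_sqNorm_mul_eq_sum_pointClass` with `isZdSymmetric_tau`, then the pointwise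
   bound AT THE REPRESENTATIVES ONLY — no symmetry is asked of the majorant).
§3 **Assembly with the skeleton** (`WeightedBubbleSkeletonF3`) — `tsum_sq_weighted_repBubble_le_of_pieces`: on
   the bootstrap window, for a finite diagram family with member `𝒮 k = (1, M+1, {0})`, `c > 0`, `f_i ≤ Γ_i` and
   reals `P_i` bounding the word sums of the pieces `i ∈ [m, M]`,
   `Σ_y ‖y‖₂² P_p({0 ←m→ y} ∘ {y ↔ 0}) ≤ ofReal (Σ_{i=m}^{M} p^i P_i) + ofReal ((2dp)^{M+1} Γ₃ c_k)`,
   its one-`ofReal` and `toReal` forms (`Γ₃ ≥ 0` by `nobleF3Of_nonneg`), and the fully explicit corollaries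
   `tsum_sq_weighted_repBubble_le_classSums` (pieces read through §1–§2 with per-class cuts `L_{i,N}`; every
   quantity on the right a tree object: `#pointClass`, `#sawWordsTo`, `‖·‖₂²`, `p`, `K_{1,L} = srwK d 1 L`,
   `Γ₂`, `Γ₃`, `c_k`) and `tsum_sq_weighted_repBubble_le_classAtoms` (+ `toReal_…`: the same over ABSTRACT atom
   majorants `C_{i,N} ≥ c_i`, `b_{i,N,r} ≥ c_r`, `K_{i,N} ≥ K_{1,L_{i,N}}` at an upper bound `z ≥ p` — the form
   the SRW tables fill and the frame wires) — the x-space licence of the `WBX(M)` cell; the closed forms of the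
   atoms over the SRW tables (N67-S2) and the frame wiring (N67-S1) are NOT here.
§4 **Representative-free form** — `tsum_sq_weighted_repBubble_le_classLevelAtoms` (+ `toReal_…`): the same licence with
   CLASS-UNIFORM atom majorants (`∀ x ∈ class_i(N)`: `c_i(x) ≤ C_{i,N}`, `c_r(x) ≤ b_{i,N,r}`, `K_{1,L}(x) ≤ K_{i,N}`)
   and the class weight `‖x‖₂² = Σ_j N_j j²` (`euclidNorm_sq_of_mem_pointClass`), the representatives chosen
   internally (`pointClass_nonempty`: every admissible class is inhabited) — nothing about representatives is
   left to the consumer.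

## What is NOT here

No value of any count, integral or constant; no table; no dimension; no instance; the frame-level wiring
(`NoGoFrameWBX`) and the record (`NobleInstantiate`, `NobleAssumptions`, `MeanFieldD11Cert*`, `Stage1Cells*`) are
untouched and not imported.  No cited fact, no named hypothesis, no `sorry`.

## References
* [NoBLE17-I] R. Fitzner, R. van der Hofstad, Generalized approach to the non-backtracking lace expansion,
  Probab. Theory Relat. Fields 169 (2017) 1041–1119; arXiv:1506.07969 — §5.3.1 (5.36)–(5.38), §5.3.2 (first
  display) p. 1097, §5.3.3 (last paragraph) p. 1098, (2.6)–(2.7), (2.9).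
* [FvdH17] R. Fitzner, R. van der Hofstad, Mean-field behavior for nearest-neighbor percolation in `d > 10`,
  Electron. J. Probab. 22 (2017) no. 43; arXiv:1506.07977v2 — §2.4, (2.19)–(2.23), §4.2 (4.3), (4.18) (EJP pp. 32–33).
-/

noncomputable section

namespace Literature.Probability.FitznerVanDerHofstad2017

open _root_.MeasureTheory Finset
open Literature.Barriers.CriticalPhenomena Literature.Probability.Percolation
open Literature.Probability.LatticeModels
open Literature.Barriers.CriticalPhenomena.SpreadOutIsing (latticeConv convPow)
open scoped BigOperators ENNReal

variable {d : ℕ}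

/-! ### §1. The a-priori two-point majorant with an arbitrary cut `L` -/

/-- `c_r(x) ≤ b_r(x)`: an `r`-step self-avoiding walk `0 → x` is a non-backtracking walk `0 → x`
(the count majorant used beyond the enumerated order). [cite: FitznerVanDerHofstad2017, §2.4 ("such a connecting
path is a non-backtracking walk")] -/
theorem card_sawWordsTo_le_card_nbwWordsTo (r : ℕ) (x : Site d) :
    (sawWordsTo d r x).card ≤ (nbwWordsTo d r x).card :=
  card_le_card (sawWordsTo_subset_nbwWordsTo d r x)

/-- The SRW tail of (4.18) read over SELF-AVOIDING words: `p^L Σ_{u ∈ SAW_L} τ_p(x − u(L)) ≤ (2dp)^L (D^{⋆L} ⋆ τ_p)(x)`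
(`SAW_L ⊆` bond-avoiding words, then `pow_mul_sum_trailWords_tau_le`).
[cite: FitznerVanDerHofstad2017, §4.2 (4.18) and the sentence after it (EJP p. 33; arXiv:1506.07977v2 p. 36)]
[cite: FitznerVanDerHofstad2016NoBLE, §5.3.1 (5.37) p. 1097] -/
theorem pow_mul_sum_sawWords_tau_le (p : unitInterval) (L : ℕ) (x : Site d) :
    (p : ℝ) ^ L * ∑ u ∈ sawWords d L, tau d p 0 (x - wordPos u L) ≤
      (2 * d * (p : ℝ)) ^ L * latticeConv (convPow (srwStep d) L) (tau d p 0) x :=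
  (mul_le_mul_of_nonneg_left
      (sum_le_sum_of_subset_of_nonneg (sawWords_subset_trailWords d L) fun _ _ _ => tau_nonneg p 0 _)
      (pow_nonneg p.2.1 L)).trans
    (pow_mul_sum_trailWords_tau_le p L x)

/-- **(E2) — the two-point majorant with cut `L`.**  For `d ≥ 3`, `p < p_c(ℤ^d)`, `f₂(p) ≤ Γ₂`, every `L : ℕ` and
every `x`:
`τ_p(x) ≤ Σ_{r<L} p^r c_r(x) + (2dp)^L · ((2d−2)/(2d−1)·Γ₂) · K_{1,L}(x)`,
with `c_r(x) = #sawWordsTo d r x` the number of `r`-step self-avoiding walks `0 → x` and `K_{1,L} = srwK d 1 L`.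
[FvdH17] (4.18) at `n = 0` (self-avoiding form), the tail `(2dp)^L (D^{⋆L} ⋆ τ_p)(x)` and [NoBLE17-I] §5.3.2
`(D^{⋆L} ⋆ τ_p)(x) ≤ Γ̄₂ K_{1,L}(x)`, `Γ̄₂ ≤ (2d−2)/(2d−1)·Γ₂` ((2.6)).
[cite: FitznerVanDerHofstad2017, §4.2 (4.1), (4.3), (4.18) (EJP pp. 32–33; arXiv:1506.07977v2 pp. 34–36)]
[cite: FitznerVanDerHofstad2016NoBLE, §5.3.1 (5.37), §5.3.2 (first display) p. 1097; (2.6)] -/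
theorem tau_le_sawCounts_add_srwK (hd : 3 ≤ d) (p : unitInterval) (hp : p < criticalProbI d) {Γ₂ : ℝ}
    (hΓ2 : nobleF2 d p ≤ Γ₂) (L : ℕ) (x : Site d) :
    tau d p 0 x ≤ (∑ r ∈ range L, (p : ℝ) ^ r * ((sawWordsTo d r x).card : ℝ)) +
      (2 * d * (p : ℝ)) ^ L * ((2 * d - 2) / (2 * d - 1) * Γ₂) * srwK d 1 L x := by
  have hd2 : 2 ≤ d := by omega
  have hext := tauGe_le_sawExtraction p 0 L x
  rw [tauGe_zero_eq_tau, ← range_eq_Ico] at hext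
  have htail : (p : ℝ) ^ L * ∑ u ∈ sawWords d L, tau d p 0 (x - wordPos u L) ≤
      (2 * d * (p : ℝ)) ^ L * ((2 * d - 2) / (2 * d - 1) * Γ₂) * srwK d 1 L x := by
    have h1 := srwConvTau_le_of_nobleF2_le (n := 1) (by omega) hd2 p hp hΓ2 L x
    rw [SpreadOutIsing.convPow_one_eq, pow_one] at h1
    calc (p : ℝ) ^ L * ∑ u ∈ sawWords d L, tau d p 0 (x - wordPos u L)
        ≤ (2 * d * (p : ℝ)) ^ L * latticeConv (convPow (srwStep d) L) (tau d p 0) x :=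
          pow_mul_sum_sawWords_tau_le p L x
      _ ≤ (2 * d * (p : ℝ)) ^ L * (((2 * d - 2) / (2 * d - 1) * Γ₂) * srwK d 1 L x) :=
          mul_le_mul_of_nonneg_left h1 (pow_nonneg (by have := p.2.1; positivity) L)
      _ = (2 * d * (p : ℝ)) ^ L * ((2 * d - 2) / (2 * d - 1) * Γ₂) * srwK d 1 L x := (mul_assoc _ _ _).symm
  exact hext.trans (add_le_add le_rfl htail)

/-- `(2d−2)/(2d−1)·Γ₂ ≥ 0` as soon as `f₂(p) ≤ Γ₂` (`d ≥ 2`; it dominates `Γ̄₂ ≥ 0`). [cite: FitznerVanDerHofstad2016NoBLE, (2.6)] -/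
theorem varGamma2_nonneg_of_nobleF2_le (hd : 2 ≤ d) (p : unitInterval) {Γ₂ : ℝ} (hΓ2 : nobleF2 d p ≤ Γ₂) :
    0 ≤ (2 * d - 2) / (2 * d - 1) * Γ₂ :=
  (nobleSup2_nonneg' p).trans (nobleSup2_le_of_nobleF2_le hd p hΓ2)

/-- **(E2) with count majorants.**  If `c_r(x) ≤ b_r` for every `r < L` (exact tables up to the enumerated order,
non-backtracking counts beyond it, zero below `‖x‖₁` or at the wrong parity — any valid majorants), then
`τ_p(x) ≤ Σ_{r<L} p^r b_r + (2dp)^L · ((2d−2)/(2d−1)·Γ₂) · K_{1,L}(x)`.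
[cite: FitznerVanDerHofstad2017, §4.2 (4.18) (EJP p. 33); §2.4]
[cite: FitznerVanDerHofstad2016NoBLE, §5.3.2 (first display) p. 1097; §5.3.3 p. 1098] -/
theorem tau_le_counts_add_srwK (hd : 3 ≤ d) (p : unitInterval) (hp : p < criticalProbI d) {Γ₂ : ℝ}
    (hΓ2 : nobleF2 d p ≤ Γ₂) (L : ℕ) (x : Site d) {b : ℕ → ℝ}
    (hb : ∀ r, r < L → ((sawWordsTo d r x).card : ℝ) ≤ b r) :
    tau d p 0 x ≤ (∑ r ∈ range L, (p : ℝ) ^ r * b r) +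
      (2 * d * (p : ℝ)) ^ L * ((2 * d - 2) / (2 * d - 1) * Γ₂) * srwK d 1 L x :=
  (tau_le_sawCounts_add_srwK hd p hp hΓ2 L x).trans
    (add_le_add (sum_le_sum fun r hr => mul_le_mul_of_nonneg_left (hb r (mem_range.1 hr)) (pow_nonneg p.2.1 r))
      le_rfl)

/-- **(E2) evaluated at an upper bound `z ≥ p`** (the cell is a polynomial with non-negative coefficients in the
bootstrap variable): if `c_r(x) ≤ b_r` with `b_r ≥ 0` for `r < L` and `p ≤ z`, then
`τ_p(x) ≤ Σ_{r<L} z^r b_r + (2dz)^L · ((2d−2)/(2d−1)·Γ₂) · K_{1,L}(x)`.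
[cite: FitznerVanDerHofstad2017, §4.2 (4.18) (EJP p. 33), (2.19) (μ̄_p = p ≤ Γ₁/(2d−1))]
[cite: FitznerVanDerHofstad2016NoBLE, §5.3.2 (first display) p. 1097] -/
theorem tau_le_counts_add_srwK_of_le (hd : 3 ≤ d) (p : unitInterval) (hp : p < criticalProbI d) {Γ₂ : ℝ}
    (hΓ2 : nobleF2 d p ≤ Γ₂) (L : ℕ) (x : Site d) {b : ℕ → ℝ}
    (hb : ∀ r, r < L → ((sawWordsTo d r x).card : ℝ) ≤ b r) (hb0 : ∀ r, r < L → 0 ≤ b r) {z : ℝ}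
    (hpz : (p : ℝ) ≤ z) :
    tau d p 0 x ≤ (∑ r ∈ range L, z ^ r * b r) +
      (2 * d * z) ^ L * ((2 * d - 2) / (2 * d - 1) * Γ₂) * srwK d 1 L x := by
  have hp0 : 0 ≤ (p : ℝ) := p.2.1
  have hγ : 0 ≤ (2 * d - 2) / (2 * d - 1) * Γ₂ := varGamma2_nonneg_of_nobleF2_le (by omega) p hΓ2
  refine (tau_le_counts_add_srwK hd p hp hΓ2 L x hb).trans (add_le_add ?_ ?_)
  · exact sum_le_sum fun r hr =>
      mul_le_mul_of_nonneg_right (pow_le_pow_left₀ hp0 hpz r) (hb0 r (mem_range.1 hr))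
  · have h2d : 0 ≤ 2 * (d : ℝ) := by positivity
    exact mul_le_mul_of_nonneg_right
      (mul_le_mul_of_nonneg_right
        (pow_le_pow_left₀ (mul_nonneg h2d hp0) (mul_le_mul_of_nonneg_left hpz h2d) L) hγ)
      (srwK_nonneg 1 L x)

/-! ### §2. One explicit piece: regroup by end-point classes, then bound at the representatives -/

/-- **(E1)+(E2) for the `i`-th explicit piece.**  For any class representatives `x_N ∈ class_i(N)` (of the
non-empty classes) and any reals `G_N ≥ τ_p(x_N)`:
`Σ_{u ∈ SAW_i} ofReal ‖u(i)‖₂² · ofReal τ_p(u(i)) ≤ ofReal ( Σ_N #class_i(N) · (c_i(x_N) · (‖x_N‖₂² · G_N)) )`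
— the notebook's `Σ_class |class| · c_i(class) · ‖class‖₂² · Ḡ(class)` as an UPPER BOUND for the word sum of the
skeleton (regrouping by `W_d`-symmetry of `τ_p`, `c_i` and `‖·‖₂²`; the majorant is needed at the representatives only).
[cite: FitznerVanDerHofstad2016NoBLE, §5.3.3 (last paragraph: ℋ_z(x) = ‖x‖₂² G_z(x), the sum over x ∈ ℤ^d) p. 1098; §5.3.1 (5.38)]
[cite: FitznerVanDerHofstad2017, (2.21); notebook Percolation.nb cell 15 `Bound[WeightedBubble,k,s]`] -/
theorem sum_sawWords_sqNorm_tau_le_ofReal_classSum (p : unitInterval) (i : ℕ)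
    (rep : (Fin (i + 1) → ℕ) → Site d)
    (hrep : ∀ N ∈ Nat.antidiagonalTuple (i + 1) d, (pointClass d i N).Nonempty → rep N ∈ pointClass d i N)
    {G : (Fin (i + 1) → ℕ) → ℝ} (hG : ∀ N ∈ Nat.antidiagonalTuple (i + 1) d, tau d p 0 (rep N) ≤ G N) :
    ∑ u ∈ sawWords d i, ENNReal.ofReal (euclidNorm (wordPos u i) ^ 2) * ENNReal.ofReal (tau d p 0 (wordPos u i)) ≤
      ENNReal.ofReal (∑ N ∈ Nat.antidiagonalTuple (i + 1) d,
        ((pointClass d i N).card : ℝ) * (((sawWordsTo d i (rep N)).card : ℝ) * (euclidNorm (rep N) ^ 2 * G N))) := by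
  have hG0 : ∀ N ∈ Nat.antidiagonalTuple (i + 1) d, 0 ≤ G N := fun N hN => (tau_nonneg p 0 _).trans (hG N hN)
  rw [sum_sawWords_sqNorm_mul_eq_sum_pointClass (isZdSymmetric_tau p) i rep hrep,
    ENNReal.ofReal_sum_of_nonneg (fun N hN => mul_nonneg (Nat.cast_nonneg _)
      (mul_nonneg (Nat.cast_nonneg _) (mul_nonneg (sq_nonneg _) (hG0 N hN))))]
  refine sum_le_sum fun N hN => ?_
  rw [ENNReal.ofReal_mul (Nat.cast_nonneg _), ENNReal.ofReal_natCast, ENNReal.ofReal_mul (Nat.cast_nonneg _),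
    ENNReal.ofReal_natCast, ENNReal.ofReal_mul (sq_nonneg _), nsmul_eq_mul, nsmul_eq_mul]
  exact mul_le_mul_right (mul_le_mul_right (mul_le_mul_right (ENNReal.ofReal_le_ofReal (hG N hN)) _) _) _

/-- The real class sum of §2 is non-negative when the majorants are (bookkeeping for the `ofReal` algebra). [folklore] -/
private theorem classSum_nonneg (i : ℕ) (rep : (Fin (i + 1) → ℕ) → Site d) {G : (Fin (i + 1) → ℕ) → ℝ}
    (hG0 : ∀ N ∈ Nat.antidiagonalTuple (i + 1) d, 0 ≤ G N) :
    0 ≤ ∑ N ∈ Nat.antidiagonalTuple (i + 1) d,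
        ((pointClass d i N).card : ℝ) * (((sawWordsTo d i (rep N)).card : ℝ) * (euclidNorm (rep N) ^ 2 * G N)) :=
  sum_nonneg fun N hN => mul_nonneg (Nat.cast_nonneg _)
    (mul_nonneg (Nat.cast_nonneg _) (mul_nonneg (sq_nonneg _) (hG0 N hN)))

/-! ### §3. Assembly with the skeleton of the weighted repulsive bubble -/

/-- `sup_{x ∈ S} ℋ^{n,l}_p(x) ≥ 0` (a real `iSup` of non-negative terms, `nobleH_nonneg` of the tree; `0` if empty
or unbounded). [cite: FitznerVanDerHofstad2016NoBLE, (2.7) and (3.9)] -/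
theorem nobleSupH_nonneg (n l : ℕ) (S : Set (Site d)) (p : unitInterval) : 0 ≤ nobleSupH d n l S p :=
  Real.iSup_nonneg fun x => nobleH_nonneg n l p x.1

section Assembly

variable {ι : Type*} [Fintype ι] [Nonempty ι]

/-- `f₃^𝒮(p) ≥ 0` for positive constants `c` (it dominates the member quotient at any index, which is `≥ 0`).
[cite: FitznerVanDerHofstad2016NoBLE, (2.7)] -/
theorem nobleF3Of_nonneg (𝒮 : ι → ℕ × ℕ × Set (Site d)) {c : ι → ℝ} (hc : ∀ k, 0 < c k) (p : unitInterval) :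
    0 ≤ nobleF3Of 𝒮 c p := by
  obtain ⟨k⟩ := ‹Nonempty ι›
  exact (div_nonneg (nobleSupH_nonneg _ _ _ p) (hc k).le).trans
    (le_sup' (fun i : ι => nobleSupH d (𝒮 i).1 (𝒮 i).2.1 (𝒮 i).2.2 p / c i) (mem_univ k))

/-- On `f_i ≤ Γ_i` the constant `Γ₃ = Γ 2` is non-negative. [cite: FitznerVanDerHofstad2016NoBLE, (2.7), (2.9)] -/
theorem nobleGamma_two_nonneg {𝒮 : ι → ℕ × ℕ × Set (Site d)} {cμ : ℝ} {c : ι → ℝ} (hc : ∀ k, 0 < c k)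
    {p : unitInterval} {Γ : Fin 3 → ℝ} (hΓ : ∀ i, nobleFOf 𝒮 cμ c i p ≤ Γ i) : 0 ≤ Γ 2 :=
  (nobleF3Of_nonneg 𝒮 hc p).trans (by simpa only [nobleFOf_two] using hΓ 2)

/-- **The weighted repulsive bubble through piece majorants.**  On the bootstrap window `p ∈ (1/(2d−1), p_c)` with
`f_i(p) ≤ Γ_i` (`i = 1,2,3`, the `Fin 3`-family `nobleFOf 𝒮 cμ c` of a finite diagram family with member
`𝒮 k = (1, M+1, {0})`, constants `c > 0`), if reals `P_i ≥ 0` bound the word sums of the explicit pieces,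
`Σ_{u ∈ SAW_i} ofReal ‖u(i)‖₂² · ofReal τ_p(u(i)) ≤ ofReal P_i` for `i ∈ [m, M]`, then
`Σ_y ‖y‖₂² P_p({0 ←m→ y} ∘ {y ↔ 0}) ≤ ofReal (Σ_{i=m}^{M} p^i P_i) + ofReal ((2dp)^{M+1} Γ₃ c_k)`.
[cite: FitznerVanDerHofstad2016NoBLE, §5.3.1 (5.38), §5.3.3 (last paragraph), (2.7)/(2.9)]
[cite: FitznerVanDerHofstad2017, (2.19)–(2.21), §4.2 (4.3), (4.18)] -/
theorem tsum_sq_weighted_repBubble_le_of_pieces (hd : 2 ≤ d) {p : unitInterval}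
    (hp : p ∈ Set.Ioo (nbwThresholdI d) (criticalProbI d)) (m M : ℕ)
    {𝒮 : ι → ℕ × ℕ × Set (Site d)} {cμ : ℝ} {c : ι → ℝ} (hc : ∀ k, 0 < c k) {Γ : Fin 3 → ℝ}
    (hΓ : ∀ i, nobleFOf 𝒮 cμ c i p ≤ Γ i) {k : ι} (hk : 𝒮 k = (1, M + 1, {(0 : Site d)}))
    {P : ℕ → ℝ} (hP0 : ∀ i ∈ Icc m M, 0 ≤ P i)
    (hP : ∀ i ∈ Icc m M,
      ∑ u ∈ sawWords d i, ENNReal.ofReal (euclidNorm (wordPos u i) ^ 2) *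
          ENNReal.ofReal (tau d p 0 (wordPos u i)) ≤ ENNReal.ofReal (P i)) :
    ∑' y : Site d, ENNReal.ofReal (euclidNorm y ^ 2) *
        bondPercolation (zdGraph d) p (openConnGe m (0 : Site d) y □ openConn y 0) ≤
      ENNReal.ofReal (∑ i ∈ Icc m M, (p : ℝ) ^ i * P i) +
        ENNReal.ofReal ((2 * d * (p : ℝ)) ^ (M + 1) * (Γ 2 * c k)) := by
  have hp0 : 0 ≤ (p : ℝ) := p.2.1
  refine (tsum_sq_weighted_repBubble_le_skeleton_tau_of_nobleFOf_le hd hp m M hc hΓ hk).trans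
    (add_le_add ?_ le_rfl)
  rw [ENNReal.ofReal_sum_of_nonneg (fun i hi => mul_nonneg (pow_nonneg hp0 i) (hP0 i hi))]
  refine sum_le_sum fun i hi => ?_
  rw [ENNReal.ofReal_mul (pow_nonneg hp0 i)]
  exact mul_le_mul_right (hP i hi) _

/-- The same with ONE `ofReal` on the right (the tail is non-negative since `Γ₃ ≥ 0`, `nobleGamma_two_nonneg`):
`Σ_y ‖y‖₂² P_p({0 ←m→ y} ∘ {y ↔ 0}) ≤ ofReal (Σ_{i=m}^{M} p^i P_i + (2dp)^{M+1} Γ₃ c_k)`.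
[cite: FitznerVanDerHofstad2016NoBLE, §5.3.1 (5.38), §5.3.3 (last paragraph), (2.7)/(2.9)]
[cite: FitznerVanDerHofstad2017, (2.21), §4.2 (4.18)] -/
theorem tsum_sq_weighted_repBubble_le_ofReal_of_pieces (hd : 2 ≤ d) {p : unitInterval}
    (hp : p ∈ Set.Ioo (nbwThresholdI d) (criticalProbI d)) (m M : ℕ)
    {𝒮 : ι → ℕ × ℕ × Set (Site d)} {cμ : ℝ} {c : ι → ℝ} (hc : ∀ k, 0 < c k) {Γ : Fin 3 → ℝ}
    (hΓ : ∀ i, nobleFOf 𝒮 cμ c i p ≤ Γ i) {k : ι} (hk : 𝒮 k = (1, M + 1, {(0 : Site d)}))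
    {P : ℕ → ℝ} (hP0 : ∀ i ∈ Icc m M, 0 ≤ P i)
    (hP : ∀ i ∈ Icc m M,
      ∑ u ∈ sawWords d i, ENNReal.ofReal (euclidNorm (wordPos u i) ^ 2) *
          ENNReal.ofReal (tau d p 0 (wordPos u i)) ≤ ENNReal.ofReal (P i)) :
    ∑' y : Site d, ENNReal.ofReal (euclidNorm y ^ 2) *
        bondPercolation (zdGraph d) p (openConnGe m (0 : Site d) y □ openConn y 0) ≤
      ENNReal.ofReal ((∑ i ∈ Icc m M, (p : ℝ) ^ i * P i) + (2 * d * (p : ℝ)) ^ (M + 1) * (Γ 2 * c k)) := by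
  have hp0 : 0 ≤ (p : ℝ) := p.2.1
  have hA : 0 ≤ ∑ i ∈ Icc m M, (p : ℝ) ^ i * P i :=
    sum_nonneg fun i hi => mul_nonneg (pow_nonneg hp0 i) (hP0 i hi)
  have hB : 0 ≤ (2 * d * (p : ℝ)) ^ (M + 1) * (Γ 2 * c k) :=
    mul_nonneg (pow_nonneg (by positivity) _) (mul_nonneg (nobleGamma_two_nonneg hc hΓ) (hc k).le)
  rw [ENNReal.ofReal_add hA hB]
  exact tsum_sq_weighted_repBubble_le_of_pieces hd hp m M hc hΓ hk hP0 hP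

/-- **Real form** (what a Stage-1 cell reads): under the hypotheses of `tsum_sq_weighted_repBubble_le_of_pieces`
the `[0,∞]`-valued weighted bubble has real value
`(Σ_y ‖y‖₂² P_p({0 ←m→ y} ∘ {y ↔ 0})).toReal ≤ Σ_{i=m}^{M} p^i P_i + (2dp)^{M+1} Γ₃ c_k`.
[cite: FitznerVanDerHofstad2016NoBLE, §5.3.1 (5.38), §5.3.3 (last paragraph), (2.7)/(2.9)]
[cite: FitznerVanDerHofstad2017, (2.21), §4.2 (4.18)] -/
theorem toReal_tsum_sq_weighted_repBubble_le_of_pieces (hd : 2 ≤ d) {p : unitInterval}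
    (hp : p ∈ Set.Ioo (nbwThresholdI d) (criticalProbI d)) (m M : ℕ)
    {𝒮 : ι → ℕ × ℕ × Set (Site d)} {cμ : ℝ} {c : ι → ℝ} (hc : ∀ k, 0 < c k) {Γ : Fin 3 → ℝ}
    (hΓ : ∀ i, nobleFOf 𝒮 cμ c i p ≤ Γ i) {k : ι} (hk : 𝒮 k = (1, M + 1, {(0 : Site d)}))
    {P : ℕ → ℝ} (hP0 : ∀ i ∈ Icc m M, 0 ≤ P i)
    (hP : ∀ i ∈ Icc m M,
      ∑ u ∈ sawWords d i, ENNReal.ofReal (euclidNorm (wordPos u i) ^ 2) *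
          ENNReal.ofReal (tau d p 0 (wordPos u i)) ≤ ENNReal.ofReal (P i)) :
    (∑' y : Site d, ENNReal.ofReal (euclidNorm y ^ 2) *
        bondPercolation (zdGraph d) p (openConnGe m (0 : Site d) y □ openConn y 0)).toReal ≤
      (∑ i ∈ Icc m M, (p : ℝ) ^ i * P i) + (2 * d * (p : ℝ)) ^ (M + 1) * (Γ 2 * c k) := by
  have hp0 : 0 ≤ (p : ℝ) := p.2.1
  have hAB : 0 ≤ (∑ i ∈ Icc m M, (p : ℝ) ^ i * P i) + (2 * d * (p : ℝ)) ^ (M + 1) * (Γ 2 * c k) :=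
    add_nonneg (sum_nonneg fun i hi => mul_nonneg (pow_nonneg hp0 i) (hP0 i hi))
      (mul_nonneg (pow_nonneg (by positivity) _) (mul_nonneg (nobleGamma_two_nonneg hc hΓ) (hc k).le))
  exact ENNReal.toReal_le_of_le_ofReal hAB
    (tsum_sq_weighted_repBubble_le_ofReal_of_pieces hd hp m M hc hΓ hk hP0 hP)

/-- **The explicit x-space licence of the `WBX(M)` cell, (E1)+(E2) assembled.**  On the bootstrap window with
`f_i(p) ≤ Γ_i`, `𝒮 k = (1, M+1, {0})`, `c > 0`, `d ≥ 3`, for ANY class representatives `x_{i,N}` and ANY per-class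
cuts `L_{i,N}`:
`Σ_y ‖y‖₂² P_p({0 ←m→ y} ∘ {y ↔ 0}) ≤ ofReal ( Σ_{i=m}^{M} p^i Σ_N #class_i(N) · c_i(x_{i,N}) · ‖x_{i,N}‖₂² ·
   [ Σ_{r<L_{i,N}} p^r c_r(x_{i,N}) + (2dp)^{L_{i,N}} ((2d−2)/(2d−1) Γ₂) K_{1,L_{i,N}}(x_{i,N}) ] ) + ofReal ((2dp)^{M+1} Γ₃ c_k)`
(`Γ₂ = Γ 1`, `Γ₃ = Γ 2`) — every atom a tree object; the SRW-table closed forms of the atoms are N67-S2.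
[cite: FitznerVanDerHofstad2016NoBLE, §5.3.1 (5.36)–(5.38), §5.3.2 (first display) p. 1097, §5.3.3 (last paragraph) p. 1098, (2.6)–(2.7), (2.9)]
[cite: FitznerVanDerHofstad2017, (2.19)–(2.21), §4.2 (4.3), (4.18); notebook Percolation.nb cell 15] -/
theorem tsum_sq_weighted_repBubble_le_classSums (hd : 3 ≤ d) {p : unitInterval}
    (hp : p ∈ Set.Ioo (nbwThresholdI d) (criticalProbI d)) (m M : ℕ)
    {𝒮 : ι → ℕ × ℕ × Set (Site d)} {cμ : ℝ} {c : ι → ℝ} (hc : ∀ k, 0 < c k) {Γ : Fin 3 → ℝ}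
    (hΓ : ∀ i, nobleFOf 𝒮 cμ c i p ≤ Γ i) {k : ι} (hk : 𝒮 k = (1, M + 1, {(0 : Site d)}))
    (rep : (i : ℕ) → (Fin (i + 1) → ℕ) → Site d)
    (hrep : ∀ i, ∀ N ∈ Nat.antidiagonalTuple (i + 1) d, (pointClass d i N).Nonempty → rep i N ∈ pointClass d i N)
    (L : (i : ℕ) → (Fin (i + 1) → ℕ) → ℕ) :
    ∑' y : Site d, ENNReal.ofReal (euclidNorm y ^ 2) *
        bondPercolation (zdGraph d) p (openConnGe m (0 : Site d) y □ openConn y 0) ≤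
      ENNReal.ofReal (∑ i ∈ Icc m M, (p : ℝ) ^ i *
          ∑ N ∈ Nat.antidiagonalTuple (i + 1) d, ((pointClass d i N).card : ℝ) *
            (((sawWordsTo d i (rep i N)).card : ℝ) * (euclidNorm (rep i N) ^ 2 *
              ((∑ r ∈ range (L i N), (p : ℝ) ^ r * ((sawWordsTo d r (rep i N)).card : ℝ)) +
                (2 * d * (p : ℝ)) ^ (L i N) * ((2 * d - 2) / (2 * d - 1) * Γ 1) * srwK d 1 (L i N) (rep i N))))) +
        ENNReal.ofReal ((2 * d * (p : ℝ)) ^ (M + 1) * (Γ 2 * c k)) := by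
  have hd2 : 2 ≤ d := by omega
  have hΓ2 : nobleF2 d p ≤ Γ 1 := by simpa only [nobleFOf_one] using hΓ 1
  -- the (E2) majorant at every representative
  have hG : ∀ i, ∀ N ∈ Nat.antidiagonalTuple (i + 1) d, tau d p 0 (rep i N) ≤
      (∑ r ∈ range (L i N), (p : ℝ) ^ r * ((sawWordsTo d r (rep i N)).card : ℝ)) +
        (2 * d * (p : ℝ)) ^ (L i N) * ((2 * d - 2) / (2 * d - 1) * Γ 1) * srwK d 1 (L i N) (rep i N) :=
    fun i N _ => tau_le_sawCounts_add_srwK hd p hp.2 hΓ2 (L i N) (rep i N)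
  have hG0 : ∀ i, ∀ N ∈ Nat.antidiagonalTuple (i + 1) d, 0 ≤
      (∑ r ∈ range (L i N), (p : ℝ) ^ r * ((sawWordsTo d r (rep i N)).card : ℝ)) +
        (2 * d * (p : ℝ)) ^ (L i N) * ((2 * d - 2) / (2 * d - 1) * Γ 1) * srwK d 1 (L i N) (rep i N) :=
    fun i N hN => (tau_nonneg p 0 _).trans (hG i N hN)
  exact tsum_sq_weighted_repBubble_le_of_pieces hd2 hp m M hc hΓ hk
    (fun i _ => classSum_nonneg i (rep i) (hG0 i))
    (fun i _ => sum_sawWords_sqNorm_tau_le_ofReal_classSum p i (rep i) (hrep i) (hG i))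

/-- **The `WBX(M)` cell licence over abstract atom majorants, at an upper bound `z ≥ p`** — the form the tables
fill (N67-S2) and the frame wires (N67-S1): for any representatives `x_{i,N}`, cuts `L_{i,N}`, reals
`C_{i,N} ≥ c_i(x_{i,N})` (the explicit-step count), `b_{i,N,r} ≥ c_r(x_{i,N})`, `b ≥ 0` (the two-point counts below the
cut) and `K_{i,N} ≥ K_{1,L_{i,N}}(x_{i,N})` (the SRW far-node atom) — asked only for the orders `m ≤ i ≤ M` of the
cell — and any `z ≥ p`,
`Σ_y ‖y‖₂² P_p({0 ←m→ y} ∘ {y ↔ 0}) ≤ ofReal ( Σ_{i=m}^{M} z^i Σ_N #class_i(N) · C_{i,N} · ‖x_{i,N}‖₂² ·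
   [ Σ_{r<L_{i,N}} z^r b_{i,N,r} + (2dz)^{L_{i,N}} ((2d−2)/(2d−1) Γ₂) K_{i,N} ] ) + ofReal ((2dz)^{M+1} Γ₃ c_k)`.
[cite: FitznerVanDerHofstad2016NoBLE, §5.3.1 (5.36)–(5.38), §5.3.2 (first display) p. 1097, §5.3.3 (last paragraph) p. 1098, (2.6)–(2.7), (2.9)]
[cite: FitznerVanDerHofstad2017, (2.19)–(2.21), §4.2 (4.3), (4.18); notebook Percolation.nb cell 15 `Bound[WeightedBubble,k,s]`] -/
theorem tsum_sq_weighted_repBubble_le_classAtoms (hd : 3 ≤ d) {p : unitInterval}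
    (hp : p ∈ Set.Ioo (nbwThresholdI d) (criticalProbI d)) (m M : ℕ)
    {𝒮 : ι → ℕ × ℕ × Set (Site d)} {cμ : ℝ} {c : ι → ℝ} (hc : ∀ k, 0 < c k) {Γ : Fin 3 → ℝ}
    (hΓ : ∀ i, nobleFOf 𝒮 cμ c i p ≤ Γ i) {k : ι} (hk : 𝒮 k = (1, M + 1, {(0 : Site d)}))
    (rep : (i : ℕ) → (Fin (i + 1) → ℕ) → Site d)
    (hrep : ∀ i, ∀ N ∈ Nat.antidiagonalTuple (i + 1) d, (pointClass d i N).Nonempty → rep i N ∈ pointClass d i N)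
    (L : (i : ℕ) → (Fin (i + 1) → ℕ) → ℕ) {z : ℝ} (hpz : (p : ℝ) ≤ z)
    {C : (i : ℕ) → (Fin (i + 1) → ℕ) → ℝ}
    (hC : ∀ i ∈ Icc m M, ∀ N ∈ Nat.antidiagonalTuple (i + 1) d, ((sawWordsTo d i (rep i N)).card : ℝ) ≤ C i N)
    {b : (i : ℕ) → (Fin (i + 1) → ℕ) → ℕ → ℝ}
    (hb : ∀ i ∈ Icc m M, ∀ N ∈ Nat.antidiagonalTuple (i + 1) d, ∀ r, r < L i N →
      ((sawWordsTo d r (rep i N)).card : ℝ) ≤ b i N r)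
    (hb0 : ∀ i ∈ Icc m M, ∀ N ∈ Nat.antidiagonalTuple (i + 1) d, ∀ r, r < L i N → 0 ≤ b i N r)
    {K : (i : ℕ) → (Fin (i + 1) → ℕ) → ℝ}
    (hK : ∀ i ∈ Icc m M, ∀ N ∈ Nat.antidiagonalTuple (i + 1) d, srwK d 1 (L i N) (rep i N) ≤ K i N) :
    ∑' y : Site d, ENNReal.ofReal (euclidNorm y ^ 2) *
        bondPercolation (zdGraph d) p (openConnGe m (0 : Site d) y □ openConn y 0) ≤
      ENNReal.ofReal (∑ i ∈ Icc m M, z ^ i *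
          ∑ N ∈ Nat.antidiagonalTuple (i + 1) d, ((pointClass d i N).card : ℝ) *
            (C i N * (euclidNorm (rep i N) ^ 2 *
              ((∑ r ∈ range (L i N), z ^ r * b i N r) +
                (2 * d * z) ^ (L i N) * ((2 * d - 2) / (2 * d - 1) * Γ 1) * K i N)))) +
        ENNReal.ofReal ((2 * d * z) ^ (M + 1) * (Γ 2 * c k)) := by
  have hd2 : 2 ≤ d := by omega
  have hp0 : 0 ≤ (p : ℝ) := p.2.1
  have hz0 : 0 ≤ z := hp0.trans hpz
  have h2d : 0 ≤ 2 * (d : ℝ) := by positivity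
  have h2dz : 0 ≤ 2 * d * z := mul_nonneg h2d hz0
  have hΓ2 : nobleF2 d p ≤ Γ 1 := by simpa only [nobleFOf_one] using hΓ 1
  have hγ : 0 ≤ (2 * d - 2) / (2 * d - 1) * Γ 1 := varGamma2_nonneg_of_nobleF2_le hd2 p hΓ2
  -- the (E2) majorant at every representative, at `z`, with the atom majorants
  have hG : ∀ i ∈ Icc m M, ∀ N ∈ Nat.antidiagonalTuple (i + 1) d, tau d p 0 (rep i N) ≤
      (∑ r ∈ range (L i N), z ^ r * b i N r) +
        (2 * d * z) ^ (L i N) * ((2 * d - 2) / (2 * d - 1) * Γ 1) * K i N := fun i hi N hN =>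
    (tau_le_counts_add_srwK_of_le hd p hp.2 hΓ2 (L i N) (rep i N) (hb i hi N hN) (hb0 i hi N hN) hpz).trans
      (add_le_add le_rfl (mul_le_mul_of_nonneg_left (hK i hi N hN) (mul_nonneg (pow_nonneg h2dz _) hγ)))
  have hG0 : ∀ i ∈ Icc m M, ∀ N ∈ Nat.antidiagonalTuple (i + 1) d, 0 ≤
      (∑ r ∈ range (L i N), z ^ r * b i N r) +
        (2 * d * z) ^ (L i N) * ((2 * d - 2) / (2 * d - 1) * Γ 1) * K i N :=
    fun i hi N hN => (tau_nonneg p 0 _).trans (hG i hi N hN)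
  -- pieces with the exact `c_i` and `p^i`
  have hA := tsum_sq_weighted_repBubble_le_of_pieces hd2 hp m M hc hΓ hk
    (fun i hi => classSum_nonneg i (rep i) (hG0 i hi))
    (fun i hi => sum_sawWords_sqNorm_tau_le_ofReal_classSum p i (rep i) (hrep i) (hG i hi))
  refine hA.trans (add_le_add (ENNReal.ofReal_le_ofReal ?_) (ENNReal.ofReal_le_ofReal ?_))
  · refine sum_le_sum fun i hi => ?_
    refine mul_le_mul (pow_le_pow_left₀ hp0 hpz i) ?_ (classSum_nonneg i (rep i) (hG0 i hi)) (pow_nonneg hz0 i)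
    refine sum_le_sum fun N hN => mul_le_mul_of_nonneg_left ?_ (Nat.cast_nonneg _)
    exact mul_le_mul_of_nonneg_right (hC i hi N hN) (mul_nonneg (sq_nonneg _) (hG0 i hi N hN))
  · exact mul_le_mul_of_nonneg_right
      (pow_le_pow_left₀ (mul_nonneg h2d hp0) (mul_le_mul_of_nonneg_left hpz h2d) _)
      (mul_nonneg (nobleGamma_two_nonneg hc hΓ) (hc k).le)

/-- **Real form of the atom licence**: under the hypotheses of `tsum_sq_weighted_repBubble_le_classAtoms`,
`(Σ_y ‖y‖₂² P_p({0 ←m→ y} ∘ {y ↔ 0})).toReal ≤ Σ_{i=m}^{M} z^i Σ_N #class_i(N) C_{i,N} ‖x_{i,N}‖₂²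
  [Σ_{r<L_{i,N}} z^r b_{i,N,r} + (2dz)^{L_{i,N}} ((2d−2)/(2d−1) Γ₂) K_{i,N}] + (2dz)^{M+1} Γ₃ c_k`.
[cite: FitznerVanDerHofstad2016NoBLE, §5.3.1 (5.38), §5.3.2 (first display) p. 1097, §5.3.3 (last paragraph) p. 1098, (2.6)–(2.7), (2.9)]
[cite: FitznerVanDerHofstad2017, (2.19)–(2.21), §4.2 (4.18); notebook Percolation.nb cell 15] -/
theorem toReal_tsum_sq_weighted_repBubble_le_classAtoms (hd : 3 ≤ d) {p : unitInterval}
    (hp : p ∈ Set.Ioo (nbwThresholdI d) (criticalProbI d)) (m M : ℕ)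
    {𝒮 : ι → ℕ × ℕ × Set (Site d)} {cμ : ℝ} {c : ι → ℝ} (hc : ∀ k, 0 < c k) {Γ : Fin 3 → ℝ}
    (hΓ : ∀ i, nobleFOf 𝒮 cμ c i p ≤ Γ i) {k : ι} (hk : 𝒮 k = (1, M + 1, {(0 : Site d)}))
    (rep : (i : ℕ) → (Fin (i + 1) → ℕ) → Site d)
    (hrep : ∀ i, ∀ N ∈ Nat.antidiagonalTuple (i + 1) d, (pointClass d i N).Nonempty → rep i N ∈ pointClass d i N)
    (L : (i : ℕ) → (Fin (i + 1) → ℕ) → ℕ) {z : ℝ} (hpz : (p : ℝ) ≤ z)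
    {C : (i : ℕ) → (Fin (i + 1) → ℕ) → ℝ}
    (hC : ∀ i ∈ Icc m M, ∀ N ∈ Nat.antidiagonalTuple (i + 1) d, ((sawWordsTo d i (rep i N)).card : ℝ) ≤ C i N)
    {b : (i : ℕ) → (Fin (i + 1) → ℕ) → ℕ → ℝ}
    (hb : ∀ i ∈ Icc m M, ∀ N ∈ Nat.antidiagonalTuple (i + 1) d, ∀ r, r < L i N →
      ((sawWordsTo d r (rep i N)).card : ℝ) ≤ b i N r)
    (hb0 : ∀ i ∈ Icc m M, ∀ N ∈ Nat.antidiagonalTuple (i + 1) d, ∀ r, r < L i N → 0 ≤ b i N r)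
    {K : (i : ℕ) → (Fin (i + 1) → ℕ) → ℝ}
    (hK : ∀ i ∈ Icc m M, ∀ N ∈ Nat.antidiagonalTuple (i + 1) d, srwK d 1 (L i N) (rep i N) ≤ K i N) :
    (∑' y : Site d, ENNReal.ofReal (euclidNorm y ^ 2) *
        bondPercolation (zdGraph d) p (openConnGe m (0 : Site d) y □ openConn y 0)).toReal ≤
      (∑ i ∈ Icc m M, z ^ i *
          ∑ N ∈ Nat.antidiagonalTuple (i + 1) d, ((pointClass d i N).card : ℝ) *
            (C i N * (euclidNorm (rep i N) ^ 2 *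
              ((∑ r ∈ range (L i N), z ^ r * b i N r) +
                (2 * d * z) ^ (L i N) * ((2 * d - 2) / (2 * d - 1) * Γ 1) * K i N)))) +
        (2 * d * z) ^ (M + 1) * (Γ 2 * c k) := by
  have hd2 : 2 ≤ d := by omega
  have hp0 : 0 ≤ (p : ℝ) := p.2.1
  have hz0 : 0 ≤ z := hp0.trans hpz
  have h2dz : 0 ≤ 2 * d * z := mul_nonneg (by positivity) hz0
  have hΓ2 : nobleF2 d p ≤ Γ 1 := by simpa only [nobleFOf_one] using hΓ 1
  have hγ : 0 ≤ (2 * d - 2) / (2 * d - 1) * Γ 1 := varGamma2_nonneg_of_nobleF2_le hd2 p hΓ2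
  have hG0 : ∀ i ∈ Icc m M, ∀ N ∈ Nat.antidiagonalTuple (i + 1) d, 0 ≤
      (∑ r ∈ range (L i N), z ^ r * b i N r) +
        (2 * d * z) ^ (L i N) * ((2 * d - 2) / (2 * d - 1) * Γ 1) * K i N := fun i hi N hN =>
    add_nonneg (sum_nonneg fun r hr => mul_nonneg (pow_nonneg hz0 r) (hb0 i hi N hN r (mem_range.1 hr)))
      (mul_nonneg (mul_nonneg (pow_nonneg h2dz _) hγ)
        ((srwK_nonneg 1 (L i N) (rep i N)).trans (hK i hi N hN)))
  have hC0 : ∀ i ∈ Icc m M, ∀ N ∈ Nat.antidiagonalTuple (i + 1) d, 0 ≤ C i N :=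
    fun i hi N hN => (Nat.cast_nonneg _).trans (hC i hi N hN)
  have hA0 : 0 ≤ ∑ i ∈ Icc m M, z ^ i *
      ∑ N ∈ Nat.antidiagonalTuple (i + 1) d, ((pointClass d i N).card : ℝ) *
        (C i N * (euclidNorm (rep i N) ^ 2 *
          ((∑ r ∈ range (L i N), z ^ r * b i N r) +
            (2 * d * z) ^ (L i N) * ((2 * d - 2) / (2 * d - 1) * Γ 1) * K i N))) :=
    sum_nonneg fun i hi => mul_nonneg (pow_nonneg hz0 i) (sum_nonneg fun N hN =>
      mul_nonneg (Nat.cast_nonneg _) (mul_nonneg (hC0 i hi N hN) (mul_nonneg (sq_nonneg _) (hG0 i hi N hN))))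
  have hB0 : 0 ≤ (2 * d * z) ^ (M + 1) * (Γ 2 * c k) :=
    mul_nonneg (pow_nonneg h2dz _) (mul_nonneg (nobleGamma_two_nonneg hc hΓ) (hc k).le)
  refine ENNReal.toReal_le_of_le_ofReal (add_nonneg hA0 hB0) ?_
  rw [ENNReal.ofReal_add hA0 hB0]
  exact tsum_sq_weighted_repBubble_le_classAtoms hd hp m M hc hΓ hk rep hrep L hpz hC hb hb0 hK

/-! ### §4. Representative-free form: class-level atom majorants -/

omit [Fintype ι] [Nonempty ι] in
/-- Every end-point class of an admissible profile (`Σ_j N_j = d`) is non-empty (its cardinality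
`binom(d; N) · 2^{d−N₀}` is positive, `card_pointClass`). [cite: FitznerVanDerHofstad2016NoBLE, §5.3.3 (the sum over
x ∈ ℤ^d regrouped by symmetry)] -/
theorem pointClass_nonempty {r : ℕ} {N : Fin (r + 1) → ℕ} (hN : ∑ j, N j = d) : (pointClass d r N).Nonempty :=
  card_pos.1 (by rw [card_pointClass N hN]; exact mul_pos (Nat.multinomial_pos _ _) (pow_pos two_pos _))

/-- **The `WBX(M)` cell licence over CLASS-LEVEL atom majorants (no representatives).**  On the bootstrap window
with `f_i(p) ≤ Γ_i`, `𝒮 k = (1, M+1, {0})`, `c > 0`, `d ≥ 3`: for any per-class cuts `L_{i,N}`, any `z ≥ p`, and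
reals `C_{i,N}`, `b_{i,N,r} ≥ 0`, `K_{i,N}` dominating `c_i(x)`, `c_r(x)` (`r < L_{i,N}`) and `K_{1,L_{i,N}}(x)` for
EVERY point `x` of the class `N` (class-uniform majorants: the tables are indexed by the class; asked only for the
orders `m ≤ i ≤ M` of the cell),
`Σ_y ‖y‖₂² P_p({0 ←m→ y} ∘ {y ↔ 0}) ≤ ofReal ( Σ_{i=m}^{M} z^i Σ_N #class_i(N) · C_{i,N} · (Σ_j N_j j²) ·
   [ Σ_{r<L_{i,N}} z^r b_{i,N,r} + (2dz)^{L_{i,N}} ((2d−2)/(2d−1) Γ₂) K_{i,N} ] ) + ofReal ((2dz)^{M+1} Γ₃ c_k)`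
(`‖x‖₂² = Σ_j N_j j²` on the class, `euclidNorm_sq_of_mem_pointClass`; `#class = binom(d;N) 2^{d−N₀}`, `card_pointClass`).
[cite: FitznerVanDerHofstad2016NoBLE, §5.3.1 (5.36)–(5.38), §5.3.2 (first display) p. 1097, §5.3.3 (last paragraph) p. 1098, (2.6)–(2.7), (2.9)]
[cite: FitznerVanDerHofstad2017, (2.19)–(2.21), §4.2 (4.3), (4.18); notebook Percolation.nb cell 15 `Bound[WeightedBubble,k,s]`] -/
theorem tsum_sq_weighted_repBubble_le_classLevelAtoms (hd : 3 ≤ d) {p : unitInterval}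
    (hp : p ∈ Set.Ioo (nbwThresholdI d) (criticalProbI d)) (m M : ℕ)
    {𝒮 : ι → ℕ × ℕ × Set (Site d)} {cμ : ℝ} {c : ι → ℝ} (hc : ∀ k, 0 < c k) {Γ : Fin 3 → ℝ}
    (hΓ : ∀ i, nobleFOf 𝒮 cμ c i p ≤ Γ i) {k : ι} (hk : 𝒮 k = (1, M + 1, {(0 : Site d)}))
    (L : (i : ℕ) → (Fin (i + 1) → ℕ) → ℕ) {z : ℝ} (hpz : (p : ℝ) ≤ z)
    {C : (i : ℕ) → (Fin (i + 1) → ℕ) → ℝ}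
    (hC : ∀ i ∈ Icc m M, ∀ N ∈ Nat.antidiagonalTuple (i + 1) d, ∀ x ∈ pointClass d i N,
      ((sawWordsTo d i x).card : ℝ) ≤ C i N)
    {b : (i : ℕ) → (Fin (i + 1) → ℕ) → ℕ → ℝ}
    (hb : ∀ i ∈ Icc m M, ∀ N ∈ Nat.antidiagonalTuple (i + 1) d, ∀ x ∈ pointClass d i N, ∀ r, r < L i N →
      ((sawWordsTo d r x).card : ℝ) ≤ b i N r)
    (hb0 : ∀ i ∈ Icc m M, ∀ N ∈ Nat.antidiagonalTuple (i + 1) d, ∀ r, r < L i N → 0 ≤ b i N r)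
    {K : (i : ℕ) → (Fin (i + 1) → ℕ) → ℝ}
    (hK : ∀ i ∈ Icc m M, ∀ N ∈ Nat.antidiagonalTuple (i + 1) d, ∀ x ∈ pointClass d i N,
      srwK d 1 (L i N) x ≤ K i N) :
    ∑' y : Site d, ENNReal.ofReal (euclidNorm y ^ 2) *
        bondPercolation (zdGraph d) p (openConnGe m (0 : Site d) y □ openConn y 0) ≤
      ENNReal.ofReal (∑ i ∈ Icc m M, z ^ i *
          ∑ N ∈ Nat.antidiagonalTuple (i + 1) d, ((pointClass d i N).card : ℝ) *
            (C i N * (((∑ j : Fin (i + 1), N j * (j : ℕ) ^ 2 : ℕ) : ℝ) *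
              ((∑ r ∈ range (L i N), z ^ r * b i N r) +
                (2 * d * z) ^ (L i N) * ((2 * d - 2) / (2 * d - 1) * Γ 1) * K i N)))) +
        ENNReal.ofReal ((2 * d * z) ^ (M + 1) * (Γ 2 * c k)) := by
  -- a representative of every class (any member; `0` off the admissible profiles)
  let rep : (i : ℕ) → (Fin (i + 1) → ℕ) → Site d := fun i N =>
    if h : ∑ j, N j = d then (pointClass_nonempty (r := i) h).choose else 0
  have hmem : ∀ i, ∀ N ∈ Nat.antidiagonalTuple (i + 1) d, rep i N ∈ pointClass d i N := fun i N hN => by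
    have h : ∑ j, N j = d := Nat.mem_antidiagonalTuple.1 hN
    simp only [rep, dif_pos h]
    exact (pointClass_nonempty (r := i) h).choose_spec
  have hrep : ∀ i, ∀ N ∈ Nat.antidiagonalTuple (i + 1) d, (pointClass d i N).Nonempty →
      rep i N ∈ pointClass d i N := fun i N hN _ => hmem i N hN
  refine (tsum_sq_weighted_repBubble_le_classAtoms hd hp m M hc hΓ hk rep hrep L hpz
    (fun i hi N hN => hC i hi N hN _ (hmem i N hN)) (fun i hi N hN => hb i hi N hN _ (hmem i N hN)) hb0
    (fun i hi N hN => hK i hi N hN _ (hmem i N hN))).trans (le_of_eq ?_)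
  congr 1
  refine congrArg ENNReal.ofReal (sum_congr rfl fun i _ => ?_)
  refine congrArg (fun t => z ^ i * t) (sum_congr rfl fun N hN => ?_)
  rw [euclidNorm_sq_of_mem_pointClass (hmem i N hN)]

/-- **Real form of the class-level licence** (the inequality a Stage-1 cell reads): under the hypotheses of
`tsum_sq_weighted_repBubble_le_classLevelAtoms`,
`(Σ_y ‖y‖₂² P_p({0 ←m→ y} ∘ {y ↔ 0})).toReal ≤ Σ_{i=m}^{M} z^i Σ_N #class_i(N) C_{i,N} (Σ_j N_j j²)
  [Σ_{r<L_{i,N}} z^r b_{i,N,r} + (2dz)^{L_{i,N}} ((2d−2)/(2d−1) Γ₂) K_{i,N}] + (2dz)^{M+1} Γ₃ c_k`.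
[cite: FitznerVanDerHofstad2016NoBLE, §5.3.1 (5.38), §5.3.2 (first display) p. 1097, §5.3.3 (last paragraph) p. 1098, (2.6)–(2.7), (2.9)]
[cite: FitznerVanDerHofstad2017, (2.19)–(2.21), §4.2 (4.18); notebook Percolation.nb cell 15] -/
theorem toReal_tsum_sq_weighted_repBubble_le_classLevelAtoms (hd : 3 ≤ d) {p : unitInterval}
    (hp : p ∈ Set.Ioo (nbwThresholdI d) (criticalProbI d)) (m M : ℕ)
    {𝒮 : ι → ℕ × ℕ × Set (Site d)} {cμ : ℝ} {c : ι → ℝ} (hc : ∀ k, 0 < c k) {Γ : Fin 3 → ℝ}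
    (hΓ : ∀ i, nobleFOf 𝒮 cμ c i p ≤ Γ i) {k : ι} (hk : 𝒮 k = (1, M + 1, {(0 : Site d)}))
    (L : (i : ℕ) → (Fin (i + 1) → ℕ) → ℕ) {z : ℝ} (hpz : (p : ℝ) ≤ z)
    {C : (i : ℕ) → (Fin (i + 1) → ℕ) → ℝ}
    (hC : ∀ i ∈ Icc m M, ∀ N ∈ Nat.antidiagonalTuple (i + 1) d, ∀ x ∈ pointClass d i N,
      ((sawWordsTo d i x).card : ℝ) ≤ C i N)
    {b : (i : ℕ) → (Fin (i + 1) → ℕ) → ℕ → ℝ}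
    (hb : ∀ i ∈ Icc m M, ∀ N ∈ Nat.antidiagonalTuple (i + 1) d, ∀ x ∈ pointClass d i N, ∀ r, r < L i N →
      ((sawWordsTo d r x).card : ℝ) ≤ b i N r)
    (hb0 : ∀ i ∈ Icc m M, ∀ N ∈ Nat.antidiagonalTuple (i + 1) d, ∀ r, r < L i N → 0 ≤ b i N r)
    {K : (i : ℕ) → (Fin (i + 1) → ℕ) → ℝ}
    (hK : ∀ i ∈ Icc m M, ∀ N ∈ Nat.antidiagonalTuple (i + 1) d, ∀ x ∈ pointClass d i N,
      srwK d 1 (L i N) x ≤ K i N) :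
    (∑' y : Site d, ENNReal.ofReal (euclidNorm y ^ 2) *
        bondPercolation (zdGraph d) p (openConnGe m (0 : Site d) y □ openConn y 0)).toReal ≤
      (∑ i ∈ Icc m M, z ^ i *
          ∑ N ∈ Nat.antidiagonalTuple (i + 1) d, ((pointClass d i N).card : ℝ) *
            (C i N * (((∑ j : Fin (i + 1), N j * (j : ℕ) ^ 2 : ℕ) : ℝ) *
              ((∑ r ∈ range (L i N), z ^ r * b i N r) +
                (2 * d * z) ^ (L i N) * ((2 * d - 2) / (2 * d - 1) * Γ 1) * K i N)))) +
        (2 * d * z) ^ (M + 1) * (Γ 2 * c k) := by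
  have hd2 : 2 ≤ d := by omega
  have hp0 : 0 ≤ (p : ℝ) := p.2.1
  have hz0 : 0 ≤ z := hp0.trans hpz
  have h2dz : 0 ≤ 2 * d * z := mul_nonneg (by positivity) hz0
  have hΓ2 : nobleF2 d p ≤ Γ 1 := by simpa only [nobleFOf_one] using hΓ 1
  have hγ : 0 ≤ (2 * d - 2) / (2 * d - 1) * Γ 1 := varGamma2_nonneg_of_nobleF2_le hd2 p hΓ2
  -- a member of every admissible class, to read non-negativity of the class-uniform majorants
  have hx : ∀ i, ∀ N ∈ Nat.antidiagonalTuple (i + 1) d, ∃ x, x ∈ pointClass d i N :=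
    fun i N hN => pointClass_nonempty (r := i) (Nat.mem_antidiagonalTuple.1 hN)
  have hG0 : ∀ i ∈ Icc m M, ∀ N ∈ Nat.antidiagonalTuple (i + 1) d, 0 ≤
      (∑ r ∈ range (L i N), z ^ r * b i N r) +
        (2 * d * z) ^ (L i N) * ((2 * d - 2) / (2 * d - 1) * Γ 1) * K i N := fun i hi N hN => by
    obtain ⟨x, hxN⟩ := hx i N hN
    exact add_nonneg (sum_nonneg fun r hr => mul_nonneg (pow_nonneg hz0 r) (hb0 i hi N hN r (mem_range.1 hr)))
      (mul_nonneg (mul_nonneg (pow_nonneg h2dz _) hγ) ((srwK_nonneg 1 (L i N) x).trans (hK i hi N hN x hxN)))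
  have hC0 : ∀ i ∈ Icc m M, ∀ N ∈ Nat.antidiagonalTuple (i + 1) d, 0 ≤ C i N := fun i hi N hN => by
    obtain ⟨x, hxN⟩ := hx i N hN
    exact (Nat.cast_nonneg _).trans (hC i hi N hN x hxN)
  have hA0 : 0 ≤ ∑ i ∈ Icc m M, z ^ i *
      ∑ N ∈ Nat.antidiagonalTuple (i + 1) d, ((pointClass d i N).card : ℝ) *
        (C i N * (((∑ j : Fin (i + 1), N j * (j : ℕ) ^ 2 : ℕ) : ℝ) *
          ((∑ r ∈ range (L i N), z ^ r * b i N r) +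
            (2 * d * z) ^ (L i N) * ((2 * d - 2) / (2 * d - 1) * Γ 1) * K i N))) :=
    sum_nonneg fun i hi => mul_nonneg (pow_nonneg hz0 i) (sum_nonneg fun N hN =>
      mul_nonneg (Nat.cast_nonneg _) (mul_nonneg (hC0 i hi N hN)
        (mul_nonneg (Nat.cast_nonneg _) (hG0 i hi N hN))))
  have hB0 : 0 ≤ (2 * d * z) ^ (M + 1) * (Γ 2 * c k) :=
    mul_nonneg (pow_nonneg h2dz _) (mul_nonneg (nobleGamma_two_nonneg hc hΓ) (hc k).le)
  refine ENNReal.toReal_le_of_le_ofReal (add_nonneg hA0 hB0) ?_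
  rw [ENNReal.ofReal_add hA0 hB0]
  exact tsum_sq_weighted_repBubble_le_classLevelAtoms hd hp m M hc hΓ hk L hpz hC hb hb0 hK

end Assembly

end Literature.Probability.FitznerVanDerHofstad2017

end
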